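import Literature.MathematicalPhysics.QuantumManyBody.OneCoordinateMarginalCalculus
import Literature.MathematicalPhysics.QuantumManyBody.OneCoordinateMarginalNearWall
import Literature.MathematicalPhysics.QuantumManyBody.OneCoordinateMarginalMultiplier
import HarnessLib

/-!
# One-coordinate marginals: integrability, the primitive relation and the slice bound

Sequel to `OneCoordinateMarginal.lean` / `OneCoordinateMarginalCalculus.lean` /
`OneCoordinateMarginalNearWall.lean`. For an `N`-body wave function `ψ` and a coordinate
`p = (i,a)` we record the regularity of the slice data as functions of the distinguished
coordinate `t = x_p`:

* `integrable_integral_comp_sliceMap` : Fubini — slice integrals of an integrable function of the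
  configuration form an integrable function of `t`; hence the slice current `j`, the normal slice
  kinetic energy `e_t` (`C¹` compactly supported `ψ`) and the full slice energy `e` of a
  finite-energy trial state are integrable on `ℝ` (`integrable_sliceCurrent`,
  `integrable_normalSliceEnergyReal`, `integrable_sliceEnergyReal`);
* `hasDerivAt_marginalMassReal_comp_sub`, `marginalMassReal_comp_sub_eq_integral` : in the wall
  coordinate `s = c - t` the marginal mass `M(s) = m(c - s)` has derivative `-2 j(c - s)` and is its
  primitive (fundamental theorem of calculus);
* for a Dirichlet trial state in the box all slice data vanish off `t ∈ (0, L)`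
  (`marginalMassReal_eq_zero_of_not_mem`, `sliceCurrent_eq_zero_of_not_mem`,
  `normalSliceEnergyReal_eq_zero_of_not_mem`, `sliceEnergyReal_eq_zero_of_not_mem`), so weighted
  whole-line integrals are interval integrals in the wall coordinate
  (`integral_weight_mul_eq_intervalIntegral`);
* `ae_normalSliceEnergyReal_le_sliceEnergyReal` : `e_t(t) ≤ e(t)` for a.e. `t` (finite energy);
* the pointwise sub-sum bookkeeping `nnnorm_fderiv_sq_le_kineticDensity`, `kineticDensity_succ`,
  `interaction_succ` (splitting particle `0` off the kinetic and pair sums), and the rescaled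
  Cauchy–Schwarz bound `neg_two_mul_sliceCurrent_sq_le` (`(2j)² ≤ 4 m e_t`);
* `toReal_lintegral_weight_normSq`, `toReal_lintegral_weight_nnnorm_fderiv_sq`,
  `toReal_lintegral_weight_energyDensity` : weighted mass / normal kinetic energy / energy of a
  trial state, as lower integrals against a weight `g(c - x_p) ≥ 0`, equal the real weighted
  integrals of `m`, `e_t`, `e`.

Everything is standard measure theory / one-variable calculus and is tagged folklore.
-/

noncomputable section

namespace Literature.MathematicalPhysics.QuantumManyBody.BoseGas

open _root_.MeasureTheory Filter Set Function
open scoped ENNReal NNReal Topology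

variable {N : ℕ}

section Generic

variable {ψ : Config N → ℂ}

/-- The slice parametrisation is a measurable embedding. [folklore] -/
theorem measurableEmbedding_sliceMap (p : Fin N × Fin 3) :
    MeasurableEmbedding (sliceMap p : ℝ × (SliceIdx N p → ℝ) → Config N) := by
  have : (sliceMap p) = (sliceEquiv p : ℝ × (SliceIdx N p → ℝ) → Config N) :=
    (funext (sliceEquiv_apply p)).symm
  rw [this]; exact (sliceEquiv p).measurableEmbedding

/-- **Fubini along one coordinate (integrability)**: the slice integrals of an integrable
function of the configuration form an integrable function of the distinguished coordinate.
[folklore] -/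
theorem integrable_integral_comp_sliceMap (p : Fin N × Fin 3) {F : Config N → ℝ}
    (hF : Integrable F) :
    Integrable fun t : ℝ => ∫ y : SliceIdx N p → ℝ, F (sliceMap p (t, y)) := by
  have h := ((measurePreserving_sliceMap p).integrable_comp_emb
    (measurableEmbedding_sliceMap p)).2 hF
  rw [Measure.volume_eq_prod] at h
  exact h.integral_prod_left

/-- The slice current of a `C¹` compactly supported wave function is integrable on `ℝ`. [folklore] -/
theorem integrable_sliceCurrent (hψ : ContDiff ℝ 1 ψ) (hsupp : HasCompactSupport ψ)
    (p : Fin N × Fin 3) : Integrable (sliceCurrent ψ p) := by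
  have hF : Continuous fun X => RCLike.re (starRingEnd ℂ (ψ X) * fderiv ℝ ψ X (unitVec p.1 p.2)) :=
    RCLike.continuous_re.comp ((Complex.continuous_conj.comp hψ.continuous).mul
      ((hψ.continuous_fderiv one_ne_zero).clm_apply continuous_const))
  have hFs : HasCompactSupport fun X =>
      RCLike.re (starRingEnd ℂ (ψ X) * fderiv ℝ ψ X (unitVec p.1 p.2)) := by
    refine hsupp.mono ?_
    intro X hX
    rw [Function.mem_support] at hX ⊢
    contrapose! hX
    simp [hX]
  exact integrable_integral_comp_sliceMap p (hF.integrable_of_hasCompactSupport hFs)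

/-- The normal slice kinetic energy of a `C¹` compactly supported wave function is integrable
on `ℝ`. [folklore] -/
theorem integrable_normalSliceEnergyReal (hψ : ContDiff ℝ 1 ψ) (hsupp : HasCompactSupport ψ)
    (p : Fin N × Fin 3) : Integrable (normalSliceEnergyReal ψ p) := by
  have hF : Continuous fun X => ‖fderiv ℝ ψ X (unitVec p.1 p.2)‖ ^ 2 :=
    (((hψ.continuous_fderiv one_ne_zero).clm_apply continuous_const).norm).pow 2
  have hFs : HasCompactSupport fun X => ‖fderiv ℝ ψ X (unitVec p.1 p.2)‖ ^ 2 := by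
    refine (hsupp.fderiv (𝕜 := ℝ)).mono ?_
    intro X hX
    rw [Function.mem_support] at hX ⊢
    contrapose! hX
    simp [hX]
  exact integrable_integral_comp_sliceMap p (hF.integrable_of_hasCompactSupport hFs)

/-- The marginal mass of a `C¹` compactly supported wave function is differentiable. [folklore] -/
theorem differentiable_marginalMassReal (hψ : ContDiff ℝ 1 ψ) (hsupp : HasCompactSupport ψ)
    (p : Fin N × Fin 3) : Differentiable ℝ (marginalMassReal ψ p) :=
  fun t => (hasDerivAt_marginalMassReal hψ hsupp p t).differentiableAt

/-- The marginal mass of a `C¹` compactly supported wave function is continuous. [folklore] -/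
theorem continuous_marginalMassReal (hψ : ContDiff ℝ 1 ψ) (hsupp : HasCompactSupport ψ)
    (p : Fin N × Fin 3) : Continuous (marginalMassReal ψ p) :=
  (differentiable_marginalMassReal hψ hsupp p).continuous

/-- **Wall coordinate**: `s ↦ m(c - s)` has derivative `-2 j(c - s)`. [folklore] -/
theorem hasDerivAt_marginalMassReal_comp_sub (hψ : ContDiff ℝ 1 ψ) (hsupp : HasCompactSupport ψ)
    (p : Fin N × Fin 3) (c s : ℝ) :
    HasDerivAt (fun s : ℝ => marginalMassReal ψ p (c - s)) (-2 * sliceCurrent ψ p (c - s)) s := by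
  have h := (hasDerivAt_marginalMassReal hψ hsupp p (c - s)).comp s
    ((hasDerivAt_id' s).const_sub c)
  have h' : HasDerivAt (fun s : ℝ => marginalMassReal ψ p (c - s))
      (2 * sliceCurrent ψ p (c - s) * -1) s := h
  convert h' using 1
  ring

/-- **The marginal mass is the primitive of `-2 j` in the wall coordinate**:
`m(c - s) - m(c) = ∫₀ˢ (-2 j(c - x)) dx`. [folklore] -/
theorem marginalMassReal_comp_sub_eq_integral (hψ : ContDiff ℝ 1 ψ) (hsupp : HasCompactSupport ψ)
    (p : Fin N × Fin 3) (c s : ℝ) :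
    marginalMassReal ψ p (c - s) - marginalMassReal ψ p c =
      ∫ x in (0 : ℝ)..s, -2 * sliceCurrent ψ p (c - x) := by
  have hint : Integrable fun x : ℝ => -2 * sliceCurrent ψ p (c - x) :=
    ((integrable_sliceCurrent hψ hsupp p).comp_sub_left c).const_mul (-2)
  rw [intervalIntegral.integral_eq_sub_of_hasDerivAt
    (fun x _ => hasDerivAt_marginalMassReal_comp_sub hψ hsupp p c x) hint.intervalIntegrable]
  simp

/-- `(2 j)² ≤ 4 m e_t` (Cauchy–Schwarz on the slice, rescaled). [folklore] -/
theorem neg_two_mul_sliceCurrent_sq_le (hψ : ContDiff ℝ 1 ψ) (hsupp : HasCompactSupport ψ)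
    (p : Fin N × Fin 3) (t : ℝ) :
    (-2 * sliceCurrent ψ p t) ^ 2 ≤ 4 * marginalMassReal ψ p t * normalSliceEnergyReal ψ p t := by
  have h := sliceCurrent_sq_le hψ hsupp p t
  nlinarith [h]

/-- One squared partial derivative is at most the kinetic energy density. [folklore] -/
theorem nnnorm_fderiv_sq_le_kineticDensity (ψ : Config N → ℂ) (X : Config N) (i : Fin N)
    (k : Fin 3) :
    (‖fderiv ℝ ψ X (unitVec i k)‖₊ : ℝ≥0∞) ^ 2 ≤ kineticDensity ψ X := by
  unfold kineticDensity
  calc (‖fderiv ℝ ψ X (unitVec i k)‖₊ : ℝ≥0∞) ^ 2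
      ≤ ∑ k' : Fin 3, (‖fderiv ℝ ψ X (unitVec i k')‖₊ : ℝ≥0∞) ^ 2 :=
        Finset.single_le_sum (f := fun k' : Fin 3 => (‖fderiv ℝ ψ X (unitVec i k')‖₊ : ℝ≥0∞) ^ 2)
          (fun _ _ => zero_le) (Finset.mem_univ k)
    _ ≤ ∑ i' : Fin N, ∑ k' : Fin 3, (‖fderiv ℝ ψ X (unitVec i' k')‖₊ : ℝ≥0∞) ^ 2 :=
        Finset.single_le_sum
          (f := fun i' : Fin N => ∑ k' : Fin 3, (‖fderiv ℝ ψ X (unitVec i' k')‖₊ : ℝ≥0∞) ^ 2)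
          (fun _ _ => zero_le) (Finset.mem_univ i)

/-- Splitting particle `0` off the kinetic energy density of `n + 1` particles:
`|∇Ψ|² = ∑ₖ |∂_{0,k}Ψ|² + ∑_{i ≥ 1} ∑ₖ |∂_{i,k}Ψ|²`. [folklore] -/
theorem kineticDensity_succ {n : ℕ} (ψ : Config (n + 1) → ℂ) (X : Config (n + 1)) :
    kineticDensity ψ X = (∑ k : Fin 3, (‖fderiv ℝ ψ X (unitVec 0 k)‖₊ : ℝ≥0∞) ^ 2) +
      ∑ i : Fin n, ∑ k : Fin 3, (‖fderiv ℝ ψ X (unitVec i.succ k)‖₊ : ℝ≥0∞) ^ 2 := by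
  rw [kineticDensity, Fin.sum_univ_succ (n := n)]

/-- Splitting particle `0` off the pair interaction of `n + 1` particles:
`∑_{i<j} v(|xᵢ - xⱼ|) = ∑_{j ≥ 1} v(|x₀ - xⱼ|) + ∑_{1 ≤ i < j} v(|xᵢ - xⱼ|)`. [folklore] -/
theorem interaction_succ {n : ℕ} (v : ℝ → ℝ≥0∞) (X : Config (n + 1)) :
    interaction v X =
      (∑ j : Fin n, v (dist (X 0) (X j.succ))) + interaction v (fun j : Fin n => X j.succ) := by
  simp only [interaction, Finset.sum_filter, Fin.sum_univ_succ, Fin.succ_pos, if_true, if_false,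
    zero_add, Fin.not_lt_zero, Fin.succ_lt_succ_iff]

/-- Hence the interaction among the particles `1, …, n` is a sub-sum of the full interaction.
[folklore] -/
theorem interaction_succ_le {n : ℕ} (v : ℝ → ℝ≥0∞) (X : Config (n + 1)) :
    interaction v (fun j : Fin n => X j.succ) ≤ interaction v X := by
  rw [interaction_succ v X]
  exact le_add_self

end Generic

section TrialState

variable {L : ℝ}

/-- On a slice `x_p = t` with `t ∉ (0, L)` a Dirichlet trial state vanishes. [folklore] -/
theorem TrialState.apply_sliceMap_eq_zero (Φ : TrialState N L) (p : Fin N × Fin 3) {t : ℝ}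
    (ht : t ∉ Set.Ioo 0 L) (y : SliceIdx N p → ℝ) : Φ.ψ (sliceMap p (t, y)) = 0 :=
  Φ.eq_zero _ (sliceMap_not_mem_boxN p ht y)

/-- On a slice `x_p = t` with `t ∉ (0, L)` the gradient of a Dirichlet trial state vanishes.
[folklore] -/
theorem TrialState.fderiv_sliceMap_eq_zero (Φ : TrialState N L) (p : Fin N × Fin 3) {t : ℝ}
    (ht : t ∉ Set.Ioo 0 L) (y : SliceIdx N p → ℝ) : fderiv ℝ Φ.ψ (sliceMap p (t, y)) = 0 :=
  Φ.fderiv_eq_zero (sliceMap_not_mem_boxN p ht y)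

/-- The real marginal mass of a trial state vanishes off `(0, L)`. [folklore] -/
theorem marginalMassReal_eq_zero_of_not_mem (Φ : TrialState N L) (p : Fin N × Fin 3) {t : ℝ}
    (ht : t ∉ Set.Ioo 0 L) : marginalMassReal Φ.ψ p t = 0 := by
  simp [marginalMassReal, Φ.apply_sliceMap_eq_zero p ht]

/-- The slice current of a trial state vanishes off `(0, L)`. [folklore] -/
theorem sliceCurrent_eq_zero_of_not_mem (Φ : TrialState N L) (p : Fin N × Fin 3) {t : ℝ}
    (ht : t ∉ Set.Ioo 0 L) : sliceCurrent Φ.ψ p t = 0 := by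
  simp [sliceCurrent, Φ.apply_sliceMap_eq_zero p ht]

/-- The normal slice kinetic energy of a trial state vanishes off `(0, L)`. [folklore] -/
theorem normalSliceEnergyReal_eq_zero_of_not_mem (Φ : TrialState N L) (p : Fin N × Fin 3) {t : ℝ}
    (ht : t ∉ Set.Ioo 0 L) : normalSliceEnergyReal Φ.ψ p t = 0 := by
  simp [normalSliceEnergyReal, Φ.fderiv_sliceMap_eq_zero p ht]

/-- The real full slice energy of a trial state vanishes off `(0, L)`. [folklore] -/
theorem sliceEnergyReal_eq_zero_of_not_mem (v : ℝ → ℝ≥0∞) (Φ : TrialState N L)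
    (p : Fin N × Fin 3) {t : ℝ} (ht : t ∉ Set.Ioo 0 L) : sliceEnergyReal v Φ.ψ p t = 0 := by
  have h : ∀ y : SliceIdx N p → ℝ, kineticDensity Φ.ψ (sliceMap p (t, y)) +
      interaction v (sliceMap p (t, y)) * (‖Φ.ψ (sliceMap p (t, y))‖₊ : ℝ≥0∞) ^ 2 = 0 := by
    intro y
    simp [kineticDensity, Φ.apply_sliceMap_eq_zero p ht, Φ.fderiv_sliceMap_eq_zero p ht]
  simp [sliceEnergyReal, h]

/-- **The full slice energy of a finite-energy trial state is integrable on `ℝ`.** [folklore] -/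
theorem integrable_sliceEnergyReal {v : ℝ → ℝ≥0∞} (hv : Measurable v) (Φ : TrialState N L)
    (hE : energy v Φ ≠ ⊤) (p : Fin N × Fin 3) : Integrable (sliceEnergyReal v Φ.ψ p) := by
  have hdm : Measurable fun X => kineticDensity Φ.ψ X + interaction v X * (‖Φ.ψ X‖₊ : ℝ≥0∞) ^ 2 :=
    measurable_energyDensity hv Φ.contDiff.continuous
  have hdi : Integrable fun X =>
      (kineticDensity Φ.ψ X + interaction v X * (‖Φ.ψ X‖₊ : ℝ≥0∞) ^ 2).toReal :=
    integrable_toReal_of_lintegral_ne_top hdm.aemeasurable (by rwa [energy] at hE)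
  exact integrable_integral_comp_sliceMap p hdi

/-- **`e_t ≤ e` almost everywhere**: for a finite-energy trial state the normal slice kinetic
energy is at most the full slice energy for a.e. value of the coordinate (for every `t` whose
slice energy is finite). [folklore] -/
theorem ae_normalSliceEnergyReal_le_sliceEnergyReal {v : ℝ → ℝ≥0∞} (hv : Measurable v)
    (Φ : TrialState N L) (hE : energy v Φ ≠ ⊤) (p : Fin N × Fin 3) :
    ∀ᵐ t : ℝ, normalSliceEnergyReal Φ.ψ p t ≤ sliceEnergyReal v Φ.ψ p t := by
  have hdm : Measurable fun X => kineticDensity Φ.ψ X + interaction v X * (‖Φ.ψ X‖₊ : ℝ≥0∞) ^ 2 :=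
    measurable_energyDensity hv Φ.contDiff.continuous
  have hfin : ∫⁻ t, sliceEnergy v Φ.ψ p t ≠ ⊤ := by rwa [lintegral_sliceEnergy hv Φ p]
  have hae : ∀ᵐ t : ℝ, sliceEnergy v Φ.ψ p t < ⊤ := ae_lt_top (measurable_sliceEnergy hv Φ p) hfin
  filter_upwards [hae] with t ht
  have hsm : Measurable fun y : SliceIdx N p → ℝ => sliceMap p (t, y) :=
    (measurePreserving_sliceMap p).measurable.comp (measurable_const.prodMk measurable_id)
  have h1 : sliceEnergyReal v Φ.ψ p t = (sliceEnergy v Φ.ψ p t).toReal := by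
    rw [sliceEnergyReal, sliceEnergy, integral_toReal]
    · exact (hdm.comp hsm).aemeasurable
    · exact ae_lt_top (hdm.comp hsm) ht.ne
  have hgm : Measurable fun y : SliceIdx N p → ℝ =>
      ‖fderiv ℝ Φ.ψ (sliceMap p (t, y)) (unitVec p.1 p.2)‖ ^ 2 :=
    ((((Φ.contDiff.continuous_fderiv one_ne_zero).clm_apply continuous_const).norm.measurable.comp
      hsm).pow_const 2)
  have h2 : normalSliceEnergyReal Φ.ψ p t = (normalSliceEnergy Φ.ψ p t).toReal := by
    rw [normalSliceEnergyReal, normalSliceEnergy, integral_eq_lintegral_of_nonneg_ae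
      (Filter.Eventually.of_forall fun y => by positivity) hgm.aestronglyMeasurable]
    congr 1
    refine lintegral_congr fun y => ?_
    rw [ENNReal.ofReal_pow (norm_nonneg _), ← enorm_eq_nnnorm, ← ofReal_norm]
  rw [h1, h2]
  refine ENNReal.toReal_mono ht.ne (lintegral_mono fun y => ?_)
  exact (nnnorm_fderiv_sq_le_kineticDensity Φ.ψ _ p.1 p.2).trans le_self_add

/-- **Whole-line weighted integrals are wall-coordinate interval integrals.** If `S` vanishes off
`(0, L)` (`0 ≤ L`), then `∫ g(L - t) S(t) dt = ∫₀ᴸ g(s) S(L - s) ds`. [folklore] -/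
theorem integral_weight_mul_eq_intervalIntegral {L : ℝ} (hL : 0 ≤ L) {S : ℝ → ℝ}
    (hS : ∀ t, t ∉ Set.Ioo 0 L → S t = 0) (g : ℝ → ℝ) :
    ∫ t, g (L - t) * S t = ∫ s in (0 : ℝ)..L, g s * S (L - s) := by
  have h1 : ∫ t, g (L - t) * S t = ∫ t in (0 : ℝ)..L, g (L - t) * S t := by
    rw [intervalIntegral.integral_of_le hL]
    refine (setIntegral_eq_integral_of_forall_compl_eq_zero fun t ht => ?_).symm
    rw [hS t (fun h => ht (Set.Ioo_subset_Ioc_self h)), mul_zero]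
  rw [h1]
  have h2 := intervalIntegral.integral_comp_sub_left (fun t => g (L - t) * S t) L (a := 0) (b := L)
  simp only [sub_sub_cancel, sub_self, sub_zero] at h2
  exact h2.symm

/-! ### Weighted lower integrals as real weighted slice integrals

For a nonnegative bounded continuous weight `g(c - x_p)` of one coordinate, the weighted mass,
the weighted normal kinetic energy and the weighted energy of a trial state, written as lower
Lebesgue integrals, are the real integrals `∫ g(c - t) m(t) dt`, `∫ g(c - t) e_t(t) dt`,
`∫ g(c - t) e(t) dt` of the slice data. -/

/-- Weighted mass: `(∫⁻ g(c - x_p)|Φ|²).toReal = ∫ g(c - t) m(t) dt`. [folklore] -/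
theorem toReal_lintegral_weight_normSq (Φ : TrialState N L) {g : ℝ → ℝ} (hg : Continuous g)
    (hg0 : ∀ t, 0 ≤ g t) (hgb : ∃ C, ∀ t, |g t| ≤ C) (c : ℝ) (p : Fin N × Fin 3) :
    (∫⁻ X, ENNReal.ofReal (g (c - X p.1 p.2)) * (‖Φ.ψ X‖₊ : ℝ≥0∞) ^ 2).toReal =
      ∫ t, g (c - t) * marginalMassReal Φ.ψ p t := by
  have hF : Continuous fun X => ‖Φ.ψ X‖ ^ 2 := (Φ.contDiff.continuous.norm).pow 2
  have hFs : HasCompactSupport fun X => ‖Φ.ψ X‖ ^ 2 := by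
    refine (TrialState.hasCompactSupport' Φ).mono ?_
    intro X hX
    rw [Function.mem_support] at hX ⊢
    contrapose! hX
    simp [hX]
  obtain ⟨C, hC⟩ := hgb
  have hwm : Measurable fun X : Config N => g (c - X p.1 p.2) :=
    hg.measurable.comp (measurable_const.sub (measurable_coord' p))
  have hint := integrable_weight_mul_of_hasCompactSupport hF hFs hwm ⟨C, fun X => hC _⟩
  have hpt : ∀ X : Config N, ENNReal.ofReal (g (c - X p.1 p.2)) * (‖Φ.ψ X‖₊ : ℝ≥0∞) ^ 2 =
      ENNReal.ofReal (g (c - X p.1 p.2) * ‖Φ.ψ X‖ ^ 2) := by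
    intro X
    rw [ENNReal.ofReal_mul (hg0 _), ENNReal.ofReal_pow (norm_nonneg _), ← enorm_eq_nnnorm,
      ← ofReal_norm]
  simp_rw [hpt]
  rw [← ofReal_integral_eq_lintegral_ofReal hint
      (Filter.Eventually.of_forall fun X => mul_nonneg (hg0 _) (sq_nonneg _)),
    ENNReal.toReal_ofReal (integral_nonneg fun X => mul_nonneg (hg0 _) (sq_nonneg _))]
  exact integral_weight_normSq_eq Φ hg ⟨C, hC⟩ c p

/-- Weighted normal kinetic energy: `(∫⁻ g(c - x_p)|∂_pΦ|²).toReal = ∫ g(c - t) e_t(t) dt`.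
[folklore] -/
theorem toReal_lintegral_weight_nnnorm_fderiv_sq (Φ : TrialState N L) {g : ℝ → ℝ}
    (hg : Continuous g) (hg0 : ∀ t, 0 ≤ g t) (hgb : ∃ C, ∀ t, |g t| ≤ C) (c : ℝ)
    (p : Fin N × Fin 3) :
    (∫⁻ X, ENNReal.ofReal (g (c - X p.1 p.2)) *
        (‖fderiv ℝ Φ.ψ X (unitVec p.1 p.2)‖₊ : ℝ≥0∞) ^ 2).toReal =
      ∫ t, g (c - t) * normalSliceEnergyReal Φ.ψ p t := by
  have hF : Continuous fun X => ‖fderiv ℝ Φ.ψ X (unitVec p.1 p.2)‖ ^ 2 :=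
    (((Φ.contDiff.continuous_fderiv one_ne_zero).clm_apply continuous_const).norm).pow 2
  have hFs : HasCompactSupport fun X => ‖fderiv ℝ Φ.ψ X (unitVec p.1 p.2)‖ ^ 2 := by
    refine ((TrialState.hasCompactSupport' Φ).fderiv (𝕜 := ℝ)).mono ?_
    intro X hX
    rw [Function.mem_support] at hX ⊢
    contrapose! hX
    simp [hX]
  obtain ⟨C, hC⟩ := hgb
  have hwm : Measurable fun X : Config N => g (c - X p.1 p.2) :=
    hg.measurable.comp (measurable_const.sub (measurable_coord' p))
  have hint := integrable_weight_mul_of_hasCompactSupport hF hFs hwm ⟨C, fun X => hC _⟩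
  have hpt : ∀ X : Config N, ENNReal.ofReal (g (c - X p.1 p.2)) *
      (‖fderiv ℝ Φ.ψ X (unitVec p.1 p.2)‖₊ : ℝ≥0∞) ^ 2 =
      ENNReal.ofReal (g (c - X p.1 p.2) * ‖fderiv ℝ Φ.ψ X (unitVec p.1 p.2)‖ ^ 2) := by
    intro X
    rw [ENNReal.ofReal_mul (hg0 _), ENNReal.ofReal_pow (norm_nonneg _), ← enorm_eq_nnnorm,
      ← ofReal_norm]
  simp_rw [hpt]
  rw [← ofReal_integral_eq_lintegral_ofReal hint
      (Filter.Eventually.of_forall fun X => mul_nonneg (hg0 _) (sq_nonneg _)),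
    ENNReal.toReal_ofReal (integral_nonneg fun X => mul_nonneg (hg0 _) (sq_nonneg _))]
  exact integral_weight_mul_eq_slice p (fun t => g (c - t)) hint

/-- Weighted energy of a finite-energy state: `(∫⁻ g(c - x_p) e_Φ).toReal = ∫ g(c - t) e(t) dt`.
[folklore] -/
theorem toReal_lintegral_weight_energyDensity {v : ℝ → ℝ≥0∞} (hv : Measurable v)
    (Φ : TrialState N L) (hE : energy v Φ ≠ ⊤) {g : ℝ → ℝ} (hg : Continuous g)
    (hg0 : ∀ t, 0 ≤ g t) (hgb : ∃ C, ∀ t, |g t| ≤ C) (c : ℝ) (p : Fin N × Fin 3) :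
    (∫⁻ X, ENNReal.ofReal (g (c - X p.1 p.2)) *
        (kineticDensity Φ.ψ X + interaction v X * (‖Φ.ψ X‖₊ : ℝ≥0∞) ^ 2)).toReal =
      ∫ t, g (c - t) * sliceEnergyReal v Φ.ψ p t := by
  have hdm : Measurable fun X => kineticDensity Φ.ψ X + interaction v X * (‖Φ.ψ X‖₊ : ℝ≥0∞) ^ 2 :=
    measurable_energyDensity hv Φ.contDiff.continuous
  have hwm : Measurable fun X : Config N => ENNReal.ofReal (g (c - X p.1 p.2)) :=
    ENNReal.measurable_ofReal.comp (hg.measurable.comp (measurable_const.sub (measurable_coord' p)))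
  have hae : ∀ᵐ X : Config N, ENNReal.ofReal (g (c - X p.1 p.2)) *
      (kineticDensity Φ.ψ X + interaction v X * (‖Φ.ψ X‖₊ : ℝ≥0∞) ^ 2) < ⊤ := by
    filter_upwards [ae_lt_top hdm (by rwa [energy] at hE)] with X hX
    exact ENNReal.mul_lt_top ENNReal.ofReal_lt_top hX
  have hm : AEMeasurable fun X : Config N => ENNReal.ofReal (g (c - X p.1 p.2)) *
      (kineticDensity Φ.ψ X + interaction v X * (‖Φ.ψ X‖₊ : ℝ≥0∞) ^ 2) :=
    (hwm.mul hdm).aemeasurable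
  rw [← integral_toReal hm hae]
  simp_rw [ENNReal.toReal_mul, ENNReal.toReal_ofReal (hg0 _)]
  exact integral_weight_energyDensity_eq hv Φ hE hg hgb c p

end TrialState

end Literature.MathematicalPhysics.QuantumManyBody.BoseGas

end
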